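import Summits.BirchSwinnertonDyer.BirchSwinnertonDyer.Theorems.ResidualThetaTransportAtTwoRlfLayerIsoNorm
import Summits.BirchSwinnertonDyer.BirchSwinnertonDyer.Theorems.ResidualThetaTransportAtTwoPlusHonestLayerTwo
import HarnessLib

/-!
# Route `ResidualThetaTransportAtTwo` (RTT P6, item stmt-BirchSwinnertonDyer-23110, road T), ISO θ-plan, LAYER DICTIONARY in the REALIZATION
# currency of (R1)@2: witness classes of `H¹(U_n, E[2^J]|)` ↔ the layer `S[2^J, φ^{2^n} = 1]` of a realization `S` of `A ⊗ ℚ₂/ℤ₂`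

Lead seat `bsd-wall-tp2-p2x` g13 (cell `bsd-wall`), line `hplusdual` on 23110 (stub `stub_iso` ⟸ LAYER-ISO ⟸ θ-plan). THEOREMS ONLY (no
definition, no named fact, no instance, no `sorry`); closes nothing; 23110 is NOT proved; BSD is NOT proved by any of this.

Setting: `W/ℚ` globally minimal, `GoodSS W 2`, `a₂(W) = 0` where needed, `κ` a (cyclotomic) `ℤ₂`-extension, `v ∋ 2`, `g ∈ Γ_v` a local lift
of the topological generator, `A = ⋃ₙ E⁺(ℚ_{v,n})`, and a REALIZATION `(S, φ, ι_k)` of `A ⊗ ℚ₂/ℤ₂` with the axioms of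
`PlusDualTwo.nonempty_linearEquiv_iwasawaAlgebra_two` VERBATIM (`ι 0 = 0`, `2 ι_{k+1} = ι_k`, `S = ⋃ im ι_k`, `ker ι_k = 2^k A`,
`φ ∘ ι_k = ι_k ∘ g`). The POINT of a witnessed `U_n`-cocycle `(f, Q)` (`f(τ) = τQ − Q` on `N`, `2^J Q ∈ A`) is `ι_J(2^J Q) ∈ S`.
B. D. Kim (Compositio 143 (2007), proof of Prop. 3.15): «`H_n[p^j] = H^{Γ_n}[p^j]`, `H = E^±(k_∞) ⊗ ℚ_p/ℤ_p`» — here at `p = 2` and finite level: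

* §1 bookkeeping: `iota_eq_iota_iff` (`ι_J x = ι_J y ↔ x − y ∈ 2^J A`), `pow_apply_iota` (`φ^i ∘ ι_k = ι_k ∘ g^i`);
* §2 `point_mem_layer_of_witness` — the point of a witnessed `U_n`-class lies in the layer `S[2^J, φ^{2^n} = 1]`;
  `oneCocycleClass_eq_of_point_eq` — INJECTIVITY: equal points ⟹ equal classes ((D2)); `exists_witness_of_mem_layer` — SURJECTIVITY:
  every element of the layer is the point of a witnessed `U_n`-class ((D1) at layer `n`);
* §3 transport: `point_layerConj` (`g·` ↦ `φ`), `exists_coresLe_witness_point` (`cor_{U_{n+1}→U_n}` ↦ `1 + φ^{2^n}` — the NORM step),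
  `exists_honest_witness` (the honest image `ω̃⁻_{2m}(φ−1)·S[2^J, ω_{2m}]` of (d′) consists of points of LAYER KUMMER classes `κ_{U_{2m}}(P)`,
  `P ∈ E⁺(ℚ_{2m,v})`).

References: B. D. Kim, Compositio Math. 143 (2007), Prop. 3.15 (proof, pp. 56–57), Prop. 3.17 [BDKim2007]; S. Kobayashi, Invent. math. 152 (2003),
Thm. 6.2, Prop. 8.12 [Kobayashi2003]; R. Greenberg, LNM 1716 (1999), §4 p. 124 [GreenbergLNM1716].
-/

-- the Theorems namespace of this sub repeats the summit name by design (D-0017 nested layout)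
set_option linter.dupNamespace false

noncomputable section

open scoped Classical NumberField
open CategoryTheory Function Field NumberField IsDedekindDomain

namespace Summit.BirchSwinnertonDyer.BirchSwinnertonDyer.Theorems.SignedEC.LayerIsoAssembly

open Literature.NumberTheory.EllipticCurves Literature.NumberTheory.GaloisRepresentations WeierstrassCurve ZpExtension
  Literature.NumberTheory.EllipticCurves.Kobayashi2003 Literature.NumberTheory.EllipticCurves.Sprung2012 SignedKatoOffTwo
  TwistedLocalKummer LayerWitnessDict
open scoped ContRepresentation

universe u

variable (W : WeierstrassCurve ℚ) [W.IsElliptic] [W.IsGloballyMinimal]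

/-! ## §1 Bookkeeping along the realization -/

omit [W.IsElliptic] [W.IsGloballyMinimal] in
/-- **`ι_J x = ι_J y ↔ x − y ∈ 2^J A`** (kernel axiom + `2^J ι_J = 0`). [cite: BDKim2007, Prop. 3.17] -/
theorem iota_eq_iota_iff (κ : ZpExtension ℚ 2) (v : HeightOneSpectrum (𝓞 ℚ)) {g : absoluteGaloisGroup (v.adicCompletion ℚ)}
    {S : Type*} [AddCommGroup S] {φ : AddMonoid.End S}
    (ι : ℕ → (↥(⨆ i, signedLocalPoints κ (v.adicCompletion ℚ) W 1 i) →+ S))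
    (h0 : ∀ x, ι 0 x = 0) (hsucc : ∀ (k : ℕ) x, 2 • ι (k + 1) x = ι k x)
    (hker : ∀ (k : ℕ) (x : ↥(⨆ i, signedLocalPoints κ (v.adicCompletion ℚ) W 1 i)), ι k x = 0 →
      ∃ w : ↥(⨆ i, signedLocalPoints κ (v.adicCompletion ℚ) W 1 i), (x : localPoints W (v.adicCompletion ℚ)) = 2 ^ k • (w : localPoints W (v.adicCompletion ℚ)))
    (hequiv : ∀ (k : ℕ) (x : ↥(⨆ i, signedLocalPoints κ (v.adicCompletion ℚ) W 1 i)),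
      φ (ι k x) = ι k ⟨g • (x : localPoints W (v.adicCompletion ℚ)), PlusDualTwo.smul_mem_iSup_signedLocalPoints W κ v g x.2⟩) (J : ℕ) (x y : ↥(⨆ i, signedLocalPoints κ (v.adicCompletion ℚ) W 1 i)) :
    ι J x = ι J y ↔ ∃ w ∈ (⨆ i, signedLocalPoints κ (v.adicCompletion ℚ) W 1 i),
      (x : localPoints W (v.adicCompletion ℚ)) - y = 2 ^ J • w := by
  have _ := hequiv
  constructor
  · intro h
    have h1 : ι J (x - y) = 0 := by rw [map_sub, h, sub_self]
    obtain ⟨w, hw⟩ := hker J _ h1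
    exact ⟨w, w.2, by rw [← hw, AddSubgroup.coe_sub]⟩
  · rintro ⟨w, hwA, hw⟩
    have h1 : x - y = 2 ^ J • (⟨w, hwA⟩ : ↥(⨆ i, signedLocalPoints κ (v.adicCompletion ℚ) W 1 i)) := Subtype.ext (by rw [AddSubgroup.coe_sub, hw, AddSubgroup.coe_nsmul])
    rw [← sub_eq_zero, ← map_sub, h1, map_nsmul, ResidualThetaLayer.PlusDual.pow_nsmul_iota_eq_zero _ ι h0 hsucc]

omit [W.IsElliptic] [W.IsGloballyMinimal] in
/-- **`φ^i (ι_k x) = ι_k (g^i x)`** (iterate the equivariance axiom). [cite: BDKim2007, Prop. 3.17] -/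
theorem pow_apply_iota (κ : ZpExtension ℚ 2) (v : HeightOneSpectrum (𝓞 ℚ)) {g : absoluteGaloisGroup (v.adicCompletion ℚ)}
    {S : Type*} [AddCommGroup S] {φ : AddMonoid.End S}
    (ι : ℕ → (↥(⨆ i, signedLocalPoints κ (v.adicCompletion ℚ) W 1 i) →+ S))
    (h0 : ∀ x, ι 0 x = 0) (hsucc : ∀ (k : ℕ) x, 2 • ι (k + 1) x = ι k x)
    (hker : ∀ (k : ℕ) (x : ↥(⨆ i, signedLocalPoints κ (v.adicCompletion ℚ) W 1 i)), ι k x = 0 →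
      ∃ w : ↥(⨆ i, signedLocalPoints κ (v.adicCompletion ℚ) W 1 i), (x : localPoints W (v.adicCompletion ℚ)) = 2 ^ k • (w : localPoints W (v.adicCompletion ℚ)))
    (hequiv : ∀ (k : ℕ) (x : ↥(⨆ i, signedLocalPoints κ (v.adicCompletion ℚ) W 1 i)),
      φ (ι k x) = ι k ⟨g • (x : localPoints W (v.adicCompletion ℚ)), PlusDualTwo.smul_mem_iSup_signedLocalPoints W κ v g x.2⟩) (i k : ℕ) (x : ↥(⨆ i, signedLocalPoints κ (v.adicCompletion ℚ) W 1 i)) :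
    (φ ^ i) (ι k x) = ι k ⟨g ^ i • (x : localPoints W (v.adicCompletion ℚ)),
      PlusDualTwo.smul_mem_iSup_signedLocalPoints W κ v (g ^ i) x.2⟩ := by
  have _ := h0; have _ := hsucc; have _ := hker
  induction i with
  | zero =>
    simp only [pow_zero, one_smul]
    rfl
  | succ i ih =>
    rw [pow_succ', AddMonoid.End.coe_mul, Function.comp_apply, ih, hequiv]
    congr 1
    exact Subtype.ext (by change g • g ^ i • (x : localPoints W (v.adicCompletion ℚ)) = g ^ (i + 1) • (x : localPoints W _); rw [pow_succ', mul_smul])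

/-! ## §2 Points of witnessed classes: membership in the layer, injectivity, surjectivity -/

/-- **The point of a witnessed `U_n`-class lies in the layer `S[2^J, φ^{2^n} = 1]`** (`2^J ι_J = 0`; `φ^{2^n} ι_J(a) = ι_J(g^{2^n} a) = ι_J(a)` by
(D4)). [cite: BDKim2007, Prop. 3.15 (proof)] -/
theorem point_mem_layer_of_witness (hss : Rank1Residual.GoodSS W 2) (κ : ZpExtension ℚ 2) (J n : ℕ)
    (v : HeightOneSpectrum (𝓞 ℚ)) (hv : (2 : 𝓞 ℚ) ∈ v.asIdeal) {g : absoluteGaloisGroup (v.adicCompletion ℚ)}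
    (hg : κ.IsTopGenerator (resGalOfEmb (closureEmb (K := ℚ) (v.adicCompletion ℚ)) g))
    {S : Type*} [AddCommGroup S] {φ : AddMonoid.End S}
    (ι : ℕ → (↥(⨆ i, signedLocalPoints κ (v.adicCompletion ℚ) W 1 i) →+ S))
    (h0 : ∀ x, ι 0 x = 0) (hsucc : ∀ (k : ℕ) x, 2 • ι (k + 1) x = ι k x)
    (hker : ∀ (k : ℕ) (x : ↥(⨆ i, signedLocalPoints κ (v.adicCompletion ℚ) W 1 i)), ι k x = 0 →
      ∃ w : ↥(⨆ i, signedLocalPoints κ (v.adicCompletion ℚ) W 1 i), (x : localPoints W (v.adicCompletion ℚ)) = 2 ^ k • (w : localPoints W (v.adicCompletion ℚ)))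
    (hequiv : ∀ (k : ℕ) (x : ↥(⨆ i, signedLocalPoints κ (v.adicCompletion ℚ) W 1 i)),
      φ (ι k x) = ι k ⟨g • (x : localPoints W (v.adicCompletion ℚ)), PlusDualTwo.smul_mem_iSup_signedLocalPoints W κ v g x.2⟩)
    (f : contOneCocycles (subgroupRep (LayerPairing.torsionLocalRep W (2 ^ J) v) (LayerPairing.layerGroup κ v n))) (Q : localPoints W (v.adicCompletion ℚ))
    (hQA : 2 ^ J • Q ∈ (⨆ i, signedLocalPoints κ (v.adicCompletion ℚ) W 1 i))
    (hf : ∀ (τ : absoluteGaloisGroup (v.adicCompletion ℚ)) (hτ : τ ∈ localSubgroup κ.kerSubgroup (v.adicCompletion ℚ)),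
        pointsMap W (v.adicCompletion ℚ) ((f.1 ⟨τ, TwistLayer.localSubgroup_le_layerGroup κ v n hτ⟩ : W.geomTorsion ((2 ^ J : ℕ) : ℤ)) :
          W.geomPoints) = τ • Q - Q) :
    2 ^ J • ι J ⟨2 ^ J • Q, hQA⟩ = 0 ∧ (φ ^ 2 ^ n) (ι J ⟨2 ^ J • Q, hQA⟩) = ι J ⟨2 ^ J • Q, hQA⟩ := by
  refine ⟨ResidualThetaLayer.PlusDual.pow_nsmul_iota_eq_zero _ ι h0 hsucc J _, ?_⟩
  rw [pow_apply_iota W κ v ι h0 hsucc hker hequiv, iota_eq_iota_iff W κ v ι h0 hsucc hker hequiv]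
  exact exists_layerEigen_of_layerWitness W hss κ J n v hv hg f Q (k := J) hQA hf

/-- **INJECTIVITY of the point: witnessed `U_n`-classes with the same point are equal** (`ι_J(2^J Q) = ι_J(2^J Q')` gives
`2^J Q − 2^J Q' ∈ 2^J A`, then (D2)). [cite: BDKim2007, Prop. 3.15 (proof), Prop. 3.18] -/
theorem oneCocycleClass_eq_of_point_eq (hss : Rank1Residual.GoodSS W 2) (κ : ZpExtension ℚ 2) (J n : ℕ)
    (v : HeightOneSpectrum (𝓞 ℚ)) (hv : (2 : 𝓞 ℚ) ∈ v.asIdeal) {g : absoluteGaloisGroup (v.adicCompletion ℚ)}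
    {S : Type*} [AddCommGroup S] {φ : AddMonoid.End S}
    (ι : ℕ → (↥(⨆ i, signedLocalPoints κ (v.adicCompletion ℚ) W 1 i) →+ S))
    (h0 : ∀ x, ι 0 x = 0) (hsucc : ∀ (k : ℕ) x, 2 • ι (k + 1) x = ι k x)
    (hker : ∀ (k : ℕ) (x : ↥(⨆ i, signedLocalPoints κ (v.adicCompletion ℚ) W 1 i)), ι k x = 0 →
      ∃ w : ↥(⨆ i, signedLocalPoints κ (v.adicCompletion ℚ) W 1 i), (x : localPoints W (v.adicCompletion ℚ)) = 2 ^ k • (w : localPoints W (v.adicCompletion ℚ)))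
    (hequiv : ∀ (k : ℕ) (x : ↥(⨆ i, signedLocalPoints κ (v.adicCompletion ℚ) W 1 i)),
      φ (ι k x) = ι k ⟨g • (x : localPoints W (v.adicCompletion ℚ)), PlusDualTwo.smul_mem_iSup_signedLocalPoints W κ v g x.2⟩)
    (f f' : contOneCocycles (subgroupRep (LayerPairing.torsionLocalRep W (2 ^ J) v) (LayerPairing.layerGroup κ v n))) (Q Q' : localPoints W (v.adicCompletion ℚ))
    (hQA : 2 ^ J • Q ∈ (⨆ i, signedLocalPoints κ (v.adicCompletion ℚ) W 1 i)) (hQ'A : 2 ^ J • Q' ∈ (⨆ i, signedLocalPoints κ (v.adicCompletion ℚ) W 1 i))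
    (hf : ∀ (τ : absoluteGaloisGroup (v.adicCompletion ℚ)) (hτ : τ ∈ localSubgroup κ.kerSubgroup (v.adicCompletion ℚ)),
        pointsMap W (v.adicCompletion ℚ) ((f.1 ⟨τ, TwistLayer.localSubgroup_le_layerGroup κ v n hτ⟩ : W.geomTorsion ((2 ^ J : ℕ) : ℤ)) :
          W.geomPoints) = τ • Q - Q)
    (hf' : ∀ (τ : absoluteGaloisGroup (v.adicCompletion ℚ)) (hτ : τ ∈ localSubgroup κ.kerSubgroup (v.adicCompletion ℚ)),
        pointsMap W (v.adicCompletion ℚ) ((f'.1 ⟨τ, TwistLayer.localSubgroup_le_layerGroup κ v n hτ⟩ : W.geomTorsion ((2 ^ J : ℕ) : ℤ)) :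
          W.geomPoints) = τ • Q' - Q')
    (hpt : ι J ⟨2 ^ J • Q, hQA⟩ = ι J ⟨2 ^ J • Q', hQ'A⟩) :
    oneCocycleClass _ f = oneCocycleClass _ f' :=
  oneCocycleClass_eq_of_layerWitness_sub_mem W hss κ J n v hv f f' Q Q' hf hf'
    ((iota_eq_iota_iff W κ v ι h0 hsucc hker hequiv J _ _).mp hpt)

omit [W.IsGloballyMinimal] in
/-- **SURJECTIVITY of the point: every element of the layer `S[2^J, φ^{2^n} = 1]` is the point of a witnessed `U_n`-class** (`s = ι_J b` with
`b ∈ A`, `g^{2^n} b − b ∈ 2^J A` by the kernel axiom, then (D1) at layer `n`). [cite: BDKim2007, Prop. 3.15 (proof)] -/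
theorem exists_witness_of_mem_layer (κ : ZpExtension ℚ 2) (J n : ℕ)
    (v : HeightOneSpectrum (𝓞 ℚ)) {g : absoluteGaloisGroup (v.adicCompletion ℚ)}
    (hg : κ.IsTopGenerator (resGalOfEmb (closureEmb (K := ℚ) (v.adicCompletion ℚ)) g))
    {S : Type*} [AddCommGroup S] {φ : AddMonoid.End S}
    (ι : ℕ → (↥(⨆ i, signedLocalPoints κ (v.adicCompletion ℚ) W 1 i) →+ S))
    (h0 : ∀ x, ι 0 x = 0) (hsucc : ∀ (k : ℕ) x, 2 • ι (k + 1) x = ι k x)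
    (hker : ∀ (k : ℕ) (x : ↥(⨆ i, signedLocalPoints κ (v.adicCompletion ℚ) W 1 i)), ι k x = 0 →
      ∃ w : ↥(⨆ i, signedLocalPoints κ (v.adicCompletion ℚ) W 1 i), (x : localPoints W (v.adicCompletion ℚ)) = 2 ^ k • (w : localPoints W (v.adicCompletion ℚ)))
    (hequiv : ∀ (k : ℕ) (x : ↥(⨆ i, signedLocalPoints κ (v.adicCompletion ℚ) W 1 i)),
      φ (ι k x) = ι k ⟨g • (x : localPoints W (v.adicCompletion ℚ)), PlusDualTwo.smul_mem_iSup_signedLocalPoints W κ v g x.2⟩)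
    (hsurj : ∀ s : S, ∃ (k : ℕ) (x : ↥(⨆ i, signedLocalPoints κ (v.adicCompletion ℚ) W 1 i)), ι k x = s)
    {s : S} (hs : 2 ^ J • s = 0 ∧ (φ ^ 2 ^ n) s = s) :
    ∃ (f : contOneCocycles (subgroupRep (LayerPairing.torsionLocalRep W (2 ^ J) v) (LayerPairing.layerGroup κ v n))) (Q : localPoints W (v.adicCompletion ℚ)) (hQA : 2 ^ J • Q ∈ (⨆ i, signedLocalPoints κ (v.adicCompletion ℚ) W 1 i)),
      (∀ (τ : absoluteGaloisGroup (v.adicCompletion ℚ)) (hτ : τ ∈ localSubgroup κ.kerSubgroup (v.adicCompletion ℚ)),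
        pointsMap W (v.adicCompletion ℚ) ((f.1 ⟨τ, TwistLayer.localSubgroup_le_layerGroup κ v n hτ⟩ : W.geomTorsion ((2 ^ J : ℕ) : ℤ)) :
          W.geomPoints) = τ • Q - Q) ∧
      ι J ⟨2 ^ J • Q, hQA⟩ = s := by
  -- `s = ι_J b`
  have htor := ResidualThetaLayer.PlusDual.pow_nsmul_iota_eq_zero _ ι h0 hsucc
  have hdown : ∀ (m k : ℕ) (x : ↥(⨆ i, signedLocalPoints κ (v.adicCompletion ℚ) W 1 i)), 2 ^ m • ι (k + m) x = ι k x := by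
    intro m
    induction m with
    | zero => intro k x; rw [pow_zero, one_smul, add_zero]
    | succ m ih => intro k x; rw [pow_succ, mul_smul, ← add_assoc, hsucc, ih]
  have hshift : ∀ (m k : ℕ) (x : ↥(⨆ i, signedLocalPoints κ (v.adicCompletion ℚ) W 1 i)), ι (k + m) (2 ^ m • x) = ι k x := fun m k x ↦ by rw [map_nsmul, hdown]
  have hSJ : ∃ b : ↥(⨆ i, signedLocalPoints κ (v.adicCompletion ℚ) W 1 i), ι J b = s := by
    obtain ⟨k, x, rfl⟩ := hsurj s
    rcases le_or_gt k J with hkJ | hJk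
    · obtain ⟨m, rfl⟩ := Nat.exists_eq_add_of_le hkJ
      exact ⟨2 ^ m • x, hshift m k x⟩
    · obtain ⟨m, rfl⟩ := Nat.exists_eq_add_of_lt hJk
      have h1 : ι (m + 1) x = 0 := by rw [← hdown J (m + 1) x, show m + 1 + J = J + m + 1 by ring]; exact hs.1
      obtain ⟨w, hw⟩ := hker (m + 1) x h1
      have hx : x = 2 ^ (m + 1) • w := Subtype.ext (by rw [hw, AddSubgroup.coe_nsmul])
      exact ⟨w, by rw [hx, show J + m + 1 = J + (m + 1) by ring, hshift]⟩
  obtain ⟨b, rfl⟩ := hSJ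
  -- `g^{2^n} b − b ∈ 2^J A`
  have hfix : ∃ w ∈ (⨆ i, signedLocalPoints κ (v.adicCompletion ℚ) W 1 i), g ^ (2 ^ n) • (b : localPoints W (v.adicCompletion ℚ)) - b = 2 ^ J • w := by
    have h := hs.2
    rw [pow_apply_iota W κ v ι h0 hsucc hker hequiv, iota_eq_iota_iff W κ v ι h0 hsucc hker hequiv] at h
    exact h
  obtain ⟨ψ, Q, hQb, hψ⟩ := exists_layerCocycle_of_layerFixed_at W κ J n v hg b.2 hfix
  have hQA : 2 ^ J • Q ∈ (⨆ i, signedLocalPoints κ (v.adicCompletion ℚ) W 1 i) := by rw [hQb]; exact b.2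
  exact ⟨ψ, Q, hQA, hψ, by congr 1; exact Subtype.ext hQb⟩

/-! ## §3 Transport: conjugation ↦ `φ`, relative corestriction ↦ `1 + φ^{2^n}`, honest classes -/

omit [W.IsElliptic] [W.IsGloballyMinimal] in
/-- **`g·` ↦ `φ` on points**: `ι_J(2^J (g•Q)) = φ (ι_J(2^J Q))`. [cite: BDKim2007, Prop. 3.17] [cite: Kobayashi2003, (8.23)] -/
theorem point_smul_eq (κ : ZpExtension ℚ 2) (J : ℕ) (v : HeightOneSpectrum (𝓞 ℚ)) {g : absoluteGaloisGroup (v.adicCompletion ℚ)}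
    {S : Type*} [AddCommGroup S] {φ : AddMonoid.End S}
    (ι : ℕ → (↥(⨆ i, signedLocalPoints κ (v.adicCompletion ℚ) W 1 i) →+ S))
    (h0 : ∀ x, ι 0 x = 0) (hsucc : ∀ (k : ℕ) x, 2 • ι (k + 1) x = ι k x)
    (hker : ∀ (k : ℕ) (x : ↥(⨆ i, signedLocalPoints κ (v.adicCompletion ℚ) W 1 i)), ι k x = 0 →
      ∃ w : ↥(⨆ i, signedLocalPoints κ (v.adicCompletion ℚ) W 1 i), (x : localPoints W (v.adicCompletion ℚ)) = 2 ^ k • (w : localPoints W (v.adicCompletion ℚ)))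
    (hequiv : ∀ (k : ℕ) (x : ↥(⨆ i, signedLocalPoints κ (v.adicCompletion ℚ) W 1 i)),
      φ (ι k x) = ι k ⟨g • (x : localPoints W (v.adicCompletion ℚ)), PlusDualTwo.smul_mem_iSup_signedLocalPoints W κ v g x.2⟩)
    (Q : localPoints W (v.adicCompletion ℚ)) (hQA : 2 ^ J • Q ∈ (⨆ i, signedLocalPoints κ (v.adicCompletion ℚ) W 1 i)) :
    ι J ⟨2 ^ J • (g • Q), by
        have e1 : 2 ^ J • (g • Q) = g • (2 ^ J • Q) :=
          (map_nsmul (DistribSMul.toAddMonoidHom (localPoints W (v.adicCompletion ℚ)) g) (2 ^ J) Q).symm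
        rw [e1]
        exact PlusDualTwo.smul_mem_iSup_signedLocalPoints W κ v g hQA⟩ =
      φ (ι J ⟨2 ^ J • Q, hQA⟩) := by
  have _ := h0; have _ := hsucc; have _ := hker
  rw [hequiv]
  congr 1
  exact Subtype.ext (map_nsmul (DistribSMul.toAddMonoidHom (localPoints W (v.adicCompletion ℚ)) g) (2 ^ J) Q).symm

/-- **The NORM STEP on points: `cor_{U_{n+1}→U_n}` ↦ `1 + φ^{2^n}`.** For a witnessed `U_{n+1}`-cocycle `(f, Q)` with point
`s = ι_J(2^J Q)` there are a representative `F` of `cor[f]` and a witness `Q'` of `F`, `2^J Q' ∈ A`, with point `ι_J(2^J Q') = s + φ^{2^n} s`.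
[cite: BDKim2007, Prop. 3.15 (proof, «Cor^m_n(H_m[p^j]) = H_n[p^j]»)] [cite: NeukirchSchmidtWingberg2008, I §5 (1.5.6)–(1.5.7)] -/
theorem exists_coresLe_witness_point (hss : Rank1Residual.GoodSS W 2) (κ : ZpExtension ℚ 2) (J n : ℕ)
    (v : HeightOneSpectrum (𝓞 ℚ)) (hv : (2 : 𝓞 ℚ) ∈ v.asIdeal) {g : absoluteGaloisGroup (v.adicCompletion ℚ)}
    (hg : κ.IsTopGenerator (resGalOfEmb (closureEmb (K := ℚ) (v.adicCompletion ℚ)) g))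
    {S : Type*} [AddCommGroup S] {φ : AddMonoid.End S}
    (ι : ℕ → (↥(⨆ i, signedLocalPoints κ (v.adicCompletion ℚ) W 1 i) →+ S))
    (h0 : ∀ x, ι 0 x = 0) (hsucc : ∀ (k : ℕ) x, 2 • ι (k + 1) x = ι k x)
    (hker : ∀ (k : ℕ) (x : ↥(⨆ i, signedLocalPoints κ (v.adicCompletion ℚ) W 1 i)), ι k x = 0 →
      ∃ w : ↥(⨆ i, signedLocalPoints κ (v.adicCompletion ℚ) W 1 i), (x : localPoints W (v.adicCompletion ℚ)) = 2 ^ k • (w : localPoints W (v.adicCompletion ℚ)))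
    (hequiv : ∀ (k : ℕ) (x : ↥(⨆ i, signedLocalPoints κ (v.adicCompletion ℚ) W 1 i)),
      φ (ι k x) = ι k ⟨g • (x : localPoints W (v.adicCompletion ℚ)), PlusDualTwo.smul_mem_iSup_signedLocalPoints W κ v g x.2⟩)
    [Fintype (LayerPairing.layerGroup κ v n ⧸ (LayerPairing.layerGroup κ v (n + 1)).subgroupOf (LayerPairing.layerGroup κ v n))]
    (f : contOneCocycles (subgroupRep (LayerPairing.torsionLocalRep W (2 ^ J) v) (LayerPairing.layerGroup κ v (n + 1)))) (Q : localPoints W (v.adicCompletion ℚ)) (hQA : 2 ^ J • Q ∈ (⨆ i, signedLocalPoints κ (v.adicCompletion ℚ) W 1 i))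
    (hf : ∀ (τ : absoluteGaloisGroup (v.adicCompletion ℚ)) (hτ : τ ∈ localSubgroup κ.kerSubgroup (v.adicCompletion ℚ)),
        pointsMap W (v.adicCompletion ℚ) ((f.1 ⟨τ, TwistLayer.localSubgroup_le_layerGroup κ v (n + 1) hτ⟩ : W.geomTorsion ((2 ^ J : ℕ) : ℤ)) :
          W.geomPoints) = τ • Q - Q) :
    ∃ (F : contOneCocycles (subgroupRep (LayerPairing.torsionLocalRep W (2 ^ J) v) (LayerPairing.layerGroup κ v n))) (Q' : localPoints W (v.adicCompletion ℚ)) (hQ'A : 2 ^ J • Q' ∈ (⨆ i, signedLocalPoints κ (v.adicCompletion ℚ) W 1 i)),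
      oneCocycleClass _ F = coresLe (LayerPairing.torsionLocalRep W (2 ^ J) v) (LayerPairing.layerGroup_antitone κ v n)
        (LayerPairing.isOpen_layerGroup κ v (n + 1)) (oneCocycleClass _ f) ∧
      (∀ (τ : absoluteGaloisGroup (v.adicCompletion ℚ)) (hτ : τ ∈ localSubgroup κ.kerSubgroup (v.adicCompletion ℚ)),
        pointsMap W (v.adicCompletion ℚ) ((F.1 ⟨τ, TwistLayer.localSubgroup_le_layerGroup κ v n hτ⟩ : W.geomTorsion ((2 ^ J : ℕ) : ℤ)) :
          W.geomPoints) = τ • Q' - Q') ∧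
      ι J ⟨2 ^ J • Q', hQ'A⟩ = ι J ⟨2 ^ J • Q, hQA⟩ + (φ ^ 2 ^ n) (ι J ⟨2 ^ J • Q, hQA⟩) := by
  obtain ⟨F, Q', hF, hQ'A, hFwit, w, hwA, hw⟩ := exists_coresLe_witness_norm W hss κ J n v hv hg f Q (k := J) hQA hf
  refine ⟨F, Q', hQ'A, hF, hFwit, ?_⟩
  rw [pow_apply_iota W κ v ι h0 hsucc hker hequiv, ← map_add]
  rw [iota_eq_iota_iff W κ v ι h0 hsucc hker hequiv]
  exact ⟨w, hwA, by rw [AddSubgroup.coe_add]; exact hw⟩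

/-- **HONEST classes: the image `ω̃⁻_{2m}(φ−1)·S[2^J, ω_{2m}]` of (d′) consists of points of layer KUMMER classes** `κ_{U_{2m}}(P)`,
`P ∈ E⁺(ℚ_{2m,v}) ≤ E(ℚ_{2m,v})` (so ISO-1c applies to them): (d′) `PlusDual.iota_image_eq_image_omegaMinus` + (D7). Requires the dual pair of
(R1)@2. [cite: BDKim2007, Prop. 3.15 (proof, step (b)+(c))] [cite: Kobayashi2003, Thm. 6.2, Prop. 8.12] -/
theorem exists_honest_witness (hss : Rank1Residual.GoodSS W 2) (ha : W.frobeniusTrace 2 = 0) {κ : ZpExtension ℚ 2} (hκ : κ.IsCyclotomic)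
    (J m : ℕ) (v : HeightOneSpectrum (𝓞 ℚ)) (hv : (2 : 𝓞 ℚ) ∈ v.asIdeal) {g : absoluteGaloisGroup (v.adicCompletion ℚ)}
    (hg : κ.IsTopGenerator (resGalOfEmb (closureEmb (K := ℚ) (v.adicCompletion ℚ)) g))
    {S : Type*} [AddCommGroup S] {φ : AddMonoid.End S}
    (ι : ℕ → (↥(⨆ i, signedLocalPoints κ (v.adicCompletion ℚ) W 1 i) →+ S))
    (h0 : ∀ x, ι 0 x = 0) (hsucc : ∀ (k : ℕ) x, 2 • ι (k + 1) x = ι k x)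
    (hker : ∀ (k : ℕ) (x : ↥(⨆ i, signedLocalPoints κ (v.adicCompletion ℚ) W 1 i)), ι k x = 0 →
      ∃ w : ↥(⨆ i, signedLocalPoints κ (v.adicCompletion ℚ) W 1 i), (x : localPoints W (v.adicCompletion ℚ)) = 2 ^ k • (w : localPoints W (v.adicCompletion ℚ)))
    (hequiv : ∀ (k : ℕ) (x : ↥(⨆ i, signedLocalPoints κ (v.adicCompletion ℚ) W 1 i)),
      φ (ι k x) = ι k ⟨g • (x : localPoints W (v.adicCompletion ℚ)), PlusDualTwo.smul_mem_iSup_signedLocalPoints W κ v g x.2⟩)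
    (hsurj : ∀ s : S, ∃ (k : ℕ) (x : ↥(⨆ i, signedLocalPoints κ (v.adicCompletion ℚ) W 1 i)), ι k x = s)
    {X : Type*} [AddCommGroup X] [Module (PowerSeries ℤ_[2]) X] {toDual : X →+ (S →+ AddCircle (1 : ℚ))}
    (h : Literature.NumberTheory.EllipticCurves.IwasawaDual.IsDualPair 2 (φ - 1) toDual)
    {s : S} (hs : s ∈ (⇑(Polynomial.aeval (φ - 1) (cyclotomicOmegaMinus 2 (2 * m)))) ''
      {s : S | 2 ^ J • s = 0 ∧ Polynomial.aeval (φ - 1) (cyclotomicOmega 2 (2 * m)) s = 0}) :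
    ∃ (P : localLayerPointsOfEmb κ (closureEmb (K := ℚ) (v.adicCompletion ℚ)) W (2 * m))
      (f : contOneCocycles (subgroupRep (LayerPairing.torsionLocalRep W (2 ^ J) v) (LayerPairing.layerGroup κ v (2 * m)))) (Q : localPoints W (v.adicCompletion ℚ)) (hQA : 2 ^ J • Q ∈ (⨆ i, signedLocalPoints κ (v.adicCompletion ℚ) W 1 i)),
      oneCocycleClass _ f = LayerPairing.layerKummer W (2 ^ J) κ v (2 * m) P ∧
      (∀ (τ : absoluteGaloisGroup (v.adicCompletion ℚ)) (hτ : τ ∈ localSubgroup κ.kerSubgroup (v.adicCompletion ℚ)),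
        pointsMap W (v.adicCompletion ℚ) ((f.1 ⟨τ, TwistLayer.localSubgroup_le_layerGroup κ v (2 * m) hτ⟩ : W.geomTorsion ((2 ^ J : ℕ) : ℤ)) :
          W.geomPoints) = τ • Q - Q) ∧
      ι J ⟨2 ^ J • Q, hQA⟩ = s := by
  haveI : Fact (Nat.Prime 2) := ⟨Nat.prime_two⟩
  haveI : NeZero (2 ^ J) := ⟨pow_ne_zero _ two_ne_zero⟩
  rw [← ResidualThetaLayer.PlusDual.iota_image_eq_image_omegaMinus W hss ha hκ v hv hg h ι h0 hsucc hsurj hker hequiv m J] at hs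
  obtain ⟨x, hx, rfl⟩ := hs
  let P : localLayerPointsOfEmb κ (closureEmb (K := ℚ) (v.adicCompletion ℚ)) W (2 * m) :=
    ⟨x, signedLocalPointsOfEmb_le κ _ W 1 (2 * m) hx⟩
  obtain ⟨f, Q, hf, hQ, hwit⟩ := LayerClassPairing.exists_layerKummer_cocycle_witness W (2 ^ J) κ v (2 * m) P
  have hQ' : 2 ^ J • Q = (x : localPoints W (v.adicCompletion ℚ)) := by
    rw [← natCast_zsmul]; exact hQ
  have hQA : 2 ^ J • Q ∈ (⨆ i, signedLocalPoints κ (v.adicCompletion ℚ) W 1 i) := by rw [hQ']; exact x.2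
  exact ⟨P, f, Q, hQA, hf, hwit, by congr 1; exact Subtype.ext hQ'⟩

end Summit.BirchSwinnertonDyer.BirchSwinnertonDyer.Theorems.SignedEC.LayerIsoAssembly

end
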